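import Summits.PneNP.PneNP.Theorems.OneSliceConstantBandAdvSparseGlue
import Literature.Computability.Complexity.RossmanMonotoneCliqueCounting

/-!
# Route OneSlice, crux `ConstantBand` (stmt-PneNP-2834), line `flat-prior-relative-minterms`:
# the advantage functional of the engine `AdvSparse` is a modular valuation

The line is complete modulo its engine S4 `RelMintermSparse ↔ AdvSparse` (`OneSliceConstantBandEngineEquiv.lean`),
whose summand on the slice `i` is the planted-detection ADVANTAGE of a Boolean graph function `f`,

  `adv_i(f) := pairProb n k i (f(x ∪ K_A) = 1) − sliceProb n i (f(x) = 1)`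

(`x` uniform on `G(n,i)`, `A` an independent uniform `k`-set). This file records, as theorems about that summand
(written out; no new definition is introduced), the exact algebra every gate-by-gate argument for S4 has to live with:

* `fprm_adv_modular` (registered sub-goal of stmt-PneNP-2834): for ALL `f, g`,
  `adv_i(f ∧ g) + adv_i(f ∨ g) = adv_i(f) + adv_i(g)` — inclusion–exclusion on both counting fractions;
* `fprm_adv_nonneg`: `0 ≤ adv_i(f)` for MONOTONE `f` (coupling `x ≤ x ∪ K_A`; needs `0 < C(n,k)`);
* `fprm_adv_and_le`, `fprm_adv_or_le`: at a `{∧₂,∨₂}` gate with monotone inputs the advantage of the gate is at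
  most the sum of the advantages of its inputs, the slack being exactly the advantage of the dual gate the circuit
  did not compute;
* `fprm_adv_input_le`: a bare input `x_{e₀}` has `adv_i(x_{e₀}) ≤ (k/n)²`.

Consequences (informal, for the planners; `Cruxes/ConstantBand/Lines/flat_prior_relative_minterms-lead-c3.md` §1 and
`-lead-c4.md`): advantage is never created at a gate, it only flows up from the leaves and splits between a gate and
its uncomputed dual, so `adv_i(C) ≤ #(input→output paths of C)·(k/n)²`; every gate-ADDITIVE charging scheme for S4
measures a linear functional of the gate functions and certifies nothing beyond leaf mass × path multiplicity
(`2^depth` under fan-out). In particular every bounded `{∧,∨}`-combination of tests of vanishing advantage (count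
thresholds summed over the band, sub-pattern counts, degree statistics) has vanishing band-averaged advantage — the
"fused count ∧ structure gadget" classes need no separate refutation. A proof of S4 must track a NON-linear invariant
of the gate functions. Lead seat c4 (re-derivation of the lost c3 artefact p110816), 2026-08-16.
-/

set_option linter.dupNamespace false

namespace Summit.PneNP.PneNP.Cruxes.ConstantBand.FlatPriorRelativeMinterms

open Literature.Computability.Complexity Filter Classical
open Finset hiding slice
open Summit.PneNP.PneNP.Theorems.ConstantBand.Negative

variable {n : ℕ}

/-! ## Inclusion–exclusion for Boolean filters (instance-agnostic) -/

/-- `#{a ∈ s : u a ∧ v a} + #{a ∈ s : u a ∨ v a} = #{a ∈ s : u a} + #{a ∈ s : v a}` for Boolean tests `u, v`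
(decidability instances are implicit arguments, so that the lemma applies to the instances baked into the unfolded
counting fractions). -/
theorem fprm_card_filter_band_add_bor {α : Type*} (s : Finset α) (u v : α → Bool)
    {d₁ : DecidablePred fun a : α => (u a && v a) = true} {d₂ : DecidablePred fun a : α => (u a || v a) = true}
    {d₃ : DecidablePred fun a : α => u a = true} {d₄ : DecidablePred fun a : α => v a = true} :
    #(@Finset.filter _ (fun a => (u a && v a) = true) d₁ s) + #(@Finset.filter _ (fun a => (u a || v a) = true) d₂ s) =
      #(@Finset.filter _ (fun a => u a = true) d₃ s) + #(@Finset.filter _ (fun a => v a = true) d₄ s) := by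
  have hi : (@Finset.filter _ (fun a => (u a && v a) = true) d₁ s) =
      (@Finset.filter _ (fun a => u a = true) d₃ s) ∩ (@Finset.filter _ (fun a => v a = true) d₄ s) := by
    ext a
    simp only [mem_filter, mem_inter, Bool.and_eq_true]
    tauto
  have hu : (@Finset.filter _ (fun a => (u a || v a) = true) d₂ s) =
      (@Finset.filter _ (fun a => u a = true) d₃ s) ∪ (@Finset.filter _ (fun a => v a = true) d₄ s) := by
    ext a
    simp only [mem_filter, mem_union, Bool.or_eq_true]
    tauto
  rw [hi, hu, add_comm, card_union_add_card_inter]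

/-- Inclusion–exclusion for the planted-pair fraction. -/
theorem fprm_pairProb_band_add_bor (k i : ℕ) (f g : (Edge n → Bool) → Bool) :
    pairProb n k i (fun x A => (f (plantClique A x) && g (plantClique A x)) = true) +
        pairProb n k i (fun x A => (f (plantClique A x) || g (plantClique A x)) = true) =
      pairProb n k i (fun x A => f (plantClique A x) = true) +
        pairProb n k i (fun x A => g (plantClique A x) = true) := by
  simp only [pairProb]
  rw [← add_div, ← add_div, ← Nat.cast_add, ← Nat.cast_add]
  exact congrArg (fun m : ℕ => (m : ℝ) / _) (fprm_card_filter_band_add_bor _ _ _)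

/-- Inclusion–exclusion for the slice fraction. -/
theorem fprm_sliceProb_band_add_bor (i : ℕ) (f g : (Edge n → Bool) → Bool) :
    sliceProb n i (fun x => (f x && g x) = true) + sliceProb n i (fun x => (f x || g x) = true) =
      sliceProb n i (fun x => f x = true) + sliceProb n i (fun x => g x = true) := by
  simp only [sliceProb]
  rw [← add_div, ← add_div, ← Nat.cast_add, ← Nat.cast_add]
  exact congrArg (fun m : ℕ => (m : ℝ) / _) (fprm_card_filter_band_add_bor _ _ _)

/-! ## The registered sub-goal: modularity -/

/-- **`fprm_adv_modular`** (registered sub-goal of stmt-PneNP-2834): the planted-detection advantage on a slice is a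
MODULAR valuation on the lattice of Boolean graph functions — `adv_i(f ∧ g) + adv_i(f ∨ g) = adv_i(f) + adv_i(g)`
for all `f, g` (no monotonicity needed). -/
theorem fprm_adv_modular :
    ∀ (n k i : ℕ) (f g : (Edge n → Bool) → Bool),
      (pairProb n k i (fun x A => (f (plantClique A x) && g (plantClique A x)) = true) -
          sliceProb n i (fun x => (f x && g x) = true)) +
        (pairProb n k i (fun x A => (f (plantClique A x) || g (plantClique A x)) = true) -
          sliceProb n i (fun x => (f x || g x) = true)) =
      (pairProb n k i (fun x A => f (plantClique A x) = true) - sliceProb n i (fun x => f x = true)) +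
        (pairProb n k i (fun x A => g (plantClique A x) = true) - sliceProb n i (fun x => g x = true)) := by
  intro n k i f g
  have h1 := fprm_pairProb_band_add_bor (n := n) k i f g
  have h2 := fprm_sliceProb_band_add_bor (n := n) i f g
  linarith

/-! ## Sign and gate subadditivity for monotone inputs -/

/-- Counting fractions of the planted-pair measure are non-negative. -/
theorem fprm_pairProb_nonneg (k i : ℕ) (P : (Edge n → Bool) → Finset (Fin n) → Prop) : 0 ≤ pairProb n k i P :=
  div_nonneg (Nat.cast_nonneg _) (mul_nonneg (Nat.cast_nonneg _) (Nat.cast_nonneg _))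

/-- **Non-negativity**: for a monotone `f` (and `0 < C(n,k)`), `0 ≤ adv_i(f)` — planting only switches edges on,
so `f(x) = 1 ⟹ f(x ∪ K_A) = 1` pair by pair. -/
theorem fprm_adv_nonneg (k i : ℕ) {f : (Edge n → Bool) → Bool} (hf : Monotone f) (hnk : 0 < n.choose k) :
    0 ≤ pairProb n k i (fun x A => f (plantClique A x) = true) - sliceProb n i (fun x => f x = true) :=
  (fprm_pairProb_nonneg k i _).trans (fprm_pairProb_relMinterm_le_adv k i hf hnk)

/-- Disjunction of monotone Boolean graph functions is monotone. -/
theorem fprm_monotone_bor {f g : (Edge n → Bool) → Bool} (hf : Monotone f) (hg : Monotone g) :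
    Monotone fun x => f x || g x := by
  intro x y hxy
  have h1 := hf hxy
  have h2 := hg hxy
  rw [Bool.le_iff_imp] at h1 h2 ⊢
  simp only [Bool.or_eq_true]
  tauto

/-- Conjunction of monotone Boolean graph functions is monotone. -/
theorem fprm_monotone_band {f g : (Edge n → Bool) → Bool} (hf : Monotone f) (hg : Monotone g) :
    Monotone fun x => f x && g x := by
  intro x y hxy
  have h1 := hf hxy
  have h2 := hg hxy
  rw [Bool.le_iff_imp] at h1 h2 ⊢
  simp only [Bool.and_eq_true]
  tauto

/-- **Subadditivity at an `∧`-gate**: for monotone `f, g`, `adv_i(f ∧ g) ≤ adv_i(f) + adv_i(g)`; the slack is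
exactly `adv_i(f ∨ g) ≥ 0`, the advantage of the dual gate. -/
theorem fprm_adv_and_le (k i : ℕ) {f g : (Edge n → Bool) → Bool} (hf : Monotone f) (hg : Monotone g)
    (hnk : 0 < n.choose k) :
    pairProb n k i (fun x A => (f (plantClique A x) && g (plantClique A x)) = true) -
        sliceProb n i (fun x => (f x && g x) = true) ≤
      (pairProb n k i (fun x A => f (plantClique A x) = true) - sliceProb n i (fun x => f x = true)) +
        (pairProb n k i (fun x A => g (plantClique A x) = true) - sliceProb n i (fun x => g x = true)) := by
  have hmod := fprm_adv_modular n k i f g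
  have hor := fprm_adv_nonneg (n := n) k i (fprm_monotone_bor hf hg) hnk
  linarith

/-- **Subadditivity at an `∨`-gate**: for monotone `f, g`, `adv_i(f ∨ g) ≤ adv_i(f) + adv_i(g)`; the slack is
exactly `adv_i(f ∧ g) ≥ 0`. -/
theorem fprm_adv_or_le (k i : ℕ) {f g : (Edge n → Bool) → Bool} (hf : Monotone f) (hg : Monotone g)
    (hnk : 0 < n.choose k) :
    pairProb n k i (fun x A => (f (plantClique A x) || g (plantClique A x)) = true) -
        sliceProb n i (fun x => (f x || g x) = true) ≤
      (pairProb n k i (fun x A => f (plantClique A x) = true) - sliceProb n i (fun x => f x = true)) +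
        (pairProb n k i (fun x A => g (plantClique A x) = true) - sliceProb n i (fun x => g x = true)) := by
  have hmod := fprm_adv_modular n k i f g
  have hand := fprm_adv_nonneg (n := n) k i (fprm_monotone_band hf hg) hnk
  linarith

/-! ## The value of a bare input -/

/-- Planted pairs on which the input `e₀` reads `1`: either `x e₀ = 1` already, or `e₀ ⊆ A`. As a count:
`#{(x,A) : (x ∪ K_A) e₀ = 1} ≤ #{x : x e₀ = 1}·C(n,k) + #slice_i·#{A : endpts e₀ ⊆ A}`. -/
theorem fprm_card_pairs_input_le (k i : ℕ) (e₀ : Edge n)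
    {d₁ : DecidablePred fun xa : (Edge n → Bool) × Finset (Fin n) => plantClique xa.2 xa.1 e₀ = true}
    {d₂ : DecidablePred fun x : Edge n → Bool => x e₀ = true} :
    #(@Finset.filter _ (fun xa => plantClique xa.2 xa.1 e₀ = true) d₁
        (slice n i ×ˢ powersetCard k (univ : Finset (Fin n)))) ≤
      #(@Finset.filter _ (fun x => x e₀ = true) d₂ (slice n i)) * n.choose k +
        #(slice n i) * #((powersetCard k (univ : Finset (Fin n))).filter fun A => endpts e₀ ⊆ A) := by
  have hT : #(powersetCard k (univ : Finset (Fin n))) = n.choose k := by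
    rw [card_powersetCard, card_univ, Fintype.card_fin]
  rw [← hT, ← card_product, ← card_product]
  refine (card_le_card ?_).trans (card_union_le _ _)
  intro xa hxa
  rw [@mem_filter _ _ d₁, mem_product] at hxa
  obtain ⟨⟨hx, hA⟩, he⟩ := hxa
  simp only [plantClique, Bool.or_eq_true] at he
  rw [mem_union, mem_product, mem_product, @mem_filter _ _ d₂, mem_filter]
  rcases he with he | he
  · exact Or.inl ⟨⟨hx, he⟩, hA⟩
  · exact Or.inr ⟨hx, hA, (cliqueVec_eq_true_iff_endpts xa.2 e₀).1 he⟩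

/-- Fraction arithmetic behind the input bound: `a ≤ b·C + E·s` over `ℕ` and `s ≤ t·C` over `ℝ` give
`a/(E·C) − b/E ≤ t` (`E, C > 0`). -/
theorem fprm_frac_sub_le_of_count {a b E C s : ℕ} {t : ℝ} (hE : 0 < E) (hC : 0 < C) (h : a ≤ b * C + E * s)
    (hs : (s : ℝ) ≤ t * C) :
    (a : ℝ) / ((E : ℝ) * (C : ℝ)) - (b : ℝ) / (E : ℝ) ≤ t := by
  have hEr : (0 : ℝ) < E := by exact_mod_cast hE
  have hCr : (0 : ℝ) < C := by exact_mod_cast hC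
  have hD : (0 : ℝ) < (E : ℝ) * (C : ℝ) := mul_pos hEr hCr
  have h' : (a : ℝ) ≤ (b : ℝ) * C + (E : ℝ) * s := by exact_mod_cast h
  rw [sub_le_iff_le_add, div_le_iff₀ hD]
  have hbE : ((t : ℝ) + (b : ℝ) / E) * ((E : ℝ) * C) = t * C * E + (b : ℝ) * C := by
    field_simp
  rw [hbE]
  nlinarith [mul_le_mul_of_nonneg_right hs hEr.le]

/-- **A bare input has advantage `≤ (k/n)²`**: `adv_i(x_{e₀}) = P_i[x_{e₀} = 0]·C(n−2,k−2)/C(n,k) ≤ (k/n)²`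
(for `k ≤ n`, `0 < n`). -/
theorem fprm_adv_input_le (k i : ℕ) (e₀ : Edge n) (hkn : k ≤ n) (hn : 0 < n) :
    pairProb n k i (fun x A => plantClique A x e₀ = true) - sliceProb n i (fun x => x e₀ = true) ≤
      ((k : ℝ) / n) ^ 2 := by
  have hK : 0 < n.choose k := Nat.choose_pos hkn
  have hnr : (0 : ℝ) < n := by exact_mod_cast hn
  -- the superset count `#{A ⊇ endpts e₀}·n² ≤ k²·C(n,k)`, as `#{A ⊇ endpts e₀} ≤ (k/n)²·C(n,k)`
  have hsup : (#((powersetCard k (univ : Finset (Fin n))).filter fun A => endpts e₀ ⊆ A) : ℝ) ≤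
      ((k : ℝ) / n) ^ 2 * n.choose k := by
    have h := card_filter_supset_mul_pow_le hkn (endpts e₀)
    rw [card_endpts] at h
    have h' : (#((powersetCard k (univ : Finset (Fin n))).filter fun A => endpts e₀ ⊆ A) : ℝ) * (n : ℝ) ^ 2 ≤
        (k : ℝ) ^ 2 * n.choose k := by exact_mod_cast h
    rw [div_pow, div_mul_eq_mul_div, le_div_iff₀ (pow_pos hnr 2)]
    linarith
  simp only [pairProb, sliceProb]
  by_cases hE : #(slice n i) = 0
  · have hsl : slice n i = ∅ := card_eq_zero.1 hE
    simp only [hsl, empty_product, filter_empty, card_empty, Nat.cast_zero, zero_mul, div_zero, sub_zero]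
    positivity
  · exact fprm_frac_sub_le_of_count (Nat.pos_of_ne_zero hE) hK (fprm_card_pairs_input_le k i e₀) hsup

/-! ## Count thresholds: band-summed advantage at most `C(k,2)` -/

/-- Planting `K_A` only switches edges on: `e(x) ≤ e(x ∪ K_A)`. -/
theorem fprm_edgeCount_le_plantClique (A : Finset (Fin n)) (x : Edge n → Bool) :
    edgeCount x ≤ edgeCount (plantClique A x) := by
  unfold edgeCount
  refine card_le_card fun e he => ?_
  rw [mem_filter] at he ⊢
  exact ⟨he.1, by simp [plantClique, he.2]⟩

/-- Planting `K_A` adds at most `C(|A|,2)` edges: `e(x ∪ K_A) ≤ e(x) + C(|A|,2)`. -/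
theorem fprm_edgeCount_plantClique_le (A : Finset (Fin n)) (x : Edge n → Bool) :
    edgeCount (plantClique A x) ≤ edgeCount x + (#A).choose 2 := by
  rw [← card_filter_cliqueVec A]
  unfold edgeCount
  refine (card_le_card fun e he => ?_).trans (card_union_le _ _)
  rw [mem_filter] at he
  simp only [plantClique, Bool.or_eq_true] at he
  rw [mem_union, mem_filter, mem_filter]
  rcases he.2 with h | h
  · exact Or.inl ⟨mem_univ _, h⟩
  · exact Or.inr ⟨mem_univ _, h⟩

/-- Counting fractions of the planted-pair measure are at most `1`. -/
theorem fprm_pairProb_le_one (k i : ℕ) (P : (Edge n → Bool) → Finset (Fin n) → Prop) : pairProb n k i P ≤ 1 := by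
  simp only [pairProb]
  have hT : (#(slice n i) : ℝ) * (n.choose k : ℝ) = #(slice n i ×ˢ powersetCard k (univ : Finset (Fin n))) := by
    rw [card_product, card_powersetCard, card_univ, Fintype.card_fin, Nat.cast_mul]
  rw [hT]
  rcases (Nat.cast_nonneg (α := ℝ) #(slice n i ×ˢ powersetCard k (univ : Finset (Fin n)))).eq_or_lt with h | h
  · rw [← h, div_zero]
    exact zero_le_one
  · rw [div_le_one h]
    exact_mod_cast card_filter_le _ _

/-- Counting fractions on a slice are non-negative. -/
theorem fprm_sliceProb_nonneg (i : ℕ) (P : (Edge n → Bool) → Prop) : 0 ≤ sliceProb n i P :=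
  div_nonneg (Nat.cast_nonneg _) (Nat.cast_nonneg _)

/-- Below `t − C(k,2)` the planted threshold never fires: if `i + C(k,2) < t` then no pair `(x, A)` with `e(x) = i`,
`|A| = k` has `e(x ∪ K_A) ≥ t`. -/
theorem fprm_filter_threshold_plant_eq_empty {k i t : ℕ} (h : i + k.choose 2 < t)
    {d : DecidablePred fun xa : (Edge n → Bool) × Finset (Fin n) =>
      decide (t ≤ edgeCount (plantClique xa.2 xa.1)) = true} :
    @Finset.filter _ (fun xa => decide (t ≤ edgeCount (plantClique xa.2 xa.1)) = true) d
        (slice n i ×ˢ powersetCard k (univ : Finset (Fin n))) = ∅ := by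
  refine filter_eq_empty_iff.2 fun xa hxa ht => ?_
  rw [mem_product, ts_mem_slice, mem_powersetCard] at hxa
  rw [decide_eq_true_eq] at ht
  have h1 := fprm_edgeCount_plantClique_le xa.2 xa.1
  rw [hxa.1, hxa.2.2] at h1
  omega

/-- At or above `t` the threshold fires on the whole slice: if `t ≤ i` then `{x ∈ slice_i : e(x) ≥ t} = slice_i`. -/
theorem fprm_filter_threshold_eq_slice {i t : ℕ} (h : t ≤ i)
    {d : DecidablePred fun x : Edge n → Bool => decide (t ≤ edgeCount x) = true} :
    @Finset.filter _ (fun x => decide (t ≤ edgeCount x) = true) d (slice n i) = slice n i := by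
  refine filter_true_of_mem fun x hx => ?_
  rw [ts_mem_slice] at hx
  rw [decide_eq_true_eq, hx]
  exact h

/-- **One slice**: the advantage of the count threshold `T_{≥t}` on the slice `i` is at most `1` if
`t − C(k,2) ≤ i < t` and at most `0` otherwise. -/
theorem fprm_adv_threshold_le (k i t : ℕ) :
    pairProb n k i (fun x A => decide (t ≤ edgeCount (plantClique A x)) = true) -
        sliceProb n i (fun x => decide (t ≤ edgeCount x) = true) ≤
      if t ≤ i + k.choose 2 ∧ i < t then 1 else 0 := by
  have hp1 := fprm_pairProb_le_one (n := n) k i (fun x A => decide (t ≤ edgeCount (plantClique A x)) = true)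
  have hs0 := fprm_sliceProb_nonneg (n := n) i (fun x => decide (t ≤ edgeCount x) = true)
  split_ifs with h
  · linarith
  · rcases not_and_or.1 h with h1 | h1
    · -- `i + C(k,2) < t`: the planted threshold never fires
      have hp0 : pairProb n k i (fun x A => decide (t ≤ edgeCount (plantClique A x)) = true) = 0 := by
        simp only [pairProb]
        rw [fprm_filter_threshold_plant_eq_empty (not_le.1 h1), card_empty, Nat.cast_zero, zero_div]
      linarith
    · -- `t ≤ i`: the threshold fires on the whole slice
      by_cases hE : (#(slice n i) : ℝ) = 0
      · have hp0 : pairProb n k i (fun x A => decide (t ≤ edgeCount (plantClique A x)) = true) = 0 := by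
          simp only [pairProb]
          rw [hE, zero_mul, div_zero]
        linarith
      · have hs1 : sliceProb n i (fun x => decide (t ≤ edgeCount x) = true) = 1 := by
          simp only [sliceProb]
          rw [fprm_filter_threshold_eq_slice (not_lt.1 h1), div_self hE]
        linarith

/-- **Band sum**: over ANY set `S` of slices, the summed advantage of a count threshold `T_{≥t}` is at most
`C(k,2)` — so its average over the lower band is `≤ C(k,2)/#lower → 0` as `w → ∞` (the reason `AdvSparse` takes
`w` large after `k`; with `fprm_adv_and_le` / `fprm_adv_or_le`, every bounded `{∧,∨}`-combination of count thresholds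
with tests of vanishing advantage has vanishing band-averaged advantage). -/
theorem fprm_sum_adv_threshold_le (k t : ℕ) (S : Finset ℕ) :
    ∑ i ∈ S, (pairProb n k i (fun x A => decide (t ≤ edgeCount (plantClique A x)) = true) -
        sliceProb n i (fun x => decide (t ≤ edgeCount x) = true)) ≤ k.choose 2 := by
  calc ∑ i ∈ S, (pairProb n k i (fun x A => decide (t ≤ edgeCount (plantClique A x)) = true) -
          sliceProb n i (fun x => decide (t ≤ edgeCount x) = true))
      ≤ ∑ i ∈ S, (if t ≤ i + k.choose 2 ∧ i < t then (1 : ℝ) else 0) :=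
        sum_le_sum fun i _ => fprm_adv_threshold_le k i t
    _ = #(S.filter fun i => t ≤ i + k.choose 2 ∧ i < t) := sum_boole _ S
    _ ≤ #(Ico (t - k.choose 2) t) := by
        gcongr
        intro i hi
        rw [mem_filter] at hi
        rw [mem_Ico]
        omega
    _ ≤ k.choose 2 := by
        rw [Nat.card_Ico]
        exact_mod_cast Nat.sub_le_iff_le_add'.2 (by omega)

end Summit.PneNP.PneNP.Cruxes.ConstantBand.FlatPriorRelativeMinterms
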